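import Summits.AtomisticToContinuum.Crystallization.Theses.ThreeConeCertificate
import Summits.AtomisticToContinuum.Crystallization.Theorems.SlackRigidity.Negative.WitnessBasics
import Summits.AtomisticToContinuum.Crystallization.Theorems.ExcessDecayLiouvilleCoarseGrainsTrialBound
import Summits.AtomisticToContinuum.Crystallization.Theorems.ThreeConeCertificateSlackRigidityThinning
import Summits.AtomisticToContinuum.Crystallization.Theorems.ThreeConeCertificateSlackRigidityLocalLimit
import Summits.AtomisticToContinuum.Crystallization.Theorems.ThreeConeCertificateSlackRigidityWitness
import Summits.AtomisticToContinuum.Crystallization.Theorems.ThreeConeCertificateSlackRigidityRooting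
import Literature.MathematicalPhysics.StatisticalMechanics.BarlowStacking
import Literature.MathematicalPhysics.StatisticalMechanics.MuGroundStateConfiguration

/-!
# Crux `SlackRigidity` (stmt-AtomisticToContinuum-11960), line `c-layer-witness-strictness`:
# the TRANSFER `Layering ∧ C⁺ ⇒ SlackRigidity`, kernel-checked

`slackRigidity_of_layering_of_strictCertificate`: the LAYERING statement (exact Barlow 13-stars
everywhere ⇒ one linearly rotated Barlow stacking; registered stubs `stub_layeringOffIdeal` /
`stub_layeringIdeal`, in flight at the time of writing) together with the STRICT STAR CERTIFICATE (the line's load-bearing stub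
`stub_strictCertificate` — the route's open crux `ExactCertificate` (stmt-11959) at `P = hcp(a,h)`,
strengthened by strict complementarity (S1)/(S2) of the two local cones and by regularity of the
star functional `F`) IMPLY the crux `ThreeConeCertificate.SlackRigidity` by name.  The four other true-mathematics
stubs of the line are landed theorems and are used here: thinning (`CLayerWitnessThinning.stub_thinning`),
rooting (`CLayerWitnessRooting.stub_rooting`), local limit (`CLayerWitnessLocalLimit.stub_localLimit`),
c-layer witness (`CLayerWitnessWitness.stub_witness`); the trial-state bound is
`ExcessDecayLiouvilleCoarseGrains.stub_trialBound`.  When the layering stubs land, the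
unconditional transfer `C⁺ ⇒ SlackRigidity` follows in three lines (sibling file
`ThreeConeCertificateSlackRigidityReduction.lean`).  Composition as in the line
skeleton `Cruxes/SlackRigidity/Lines/c-layer-witness-strictness.lean` (`SlackRigidity_of`). [folklore]
-/

noncomputable section

namespace Summit.AtomisticToContinuum.Crystallization.Theorems.CLayerWitnessReduction

open scoped BigOperators Topology
open Filter Set Metric
open Literature.MathematicalPhysics.StatisticalMechanics
open Summit.AtomisticToContinuum.Crystallization.Theses.ThreeConeCertificate (SlackRigidity)
open Summit.AtomisticToContinuum.Crystallization.Theorems.SlackRigidityNegative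
  (E3 Good RigidFor ExcessVanishes BadFractionVanishes badCount slackRigidity_iff)
open Summit.AtomisticToContinuum.Crystallization.Theorems.ExcessDecayLiouvilleCoarseGrains (stub_trialBound)

/-- Translation preserves `δ`-separation. [folklore] -/
theorem separated_image_sub {Y : Set E3} {δ : ℝ}
    (hY : ∀ p ∈ Y, ∀ q ∈ Y, p ≠ q → δ ≤ dist p q) (y : E3) :
    ∀ p ∈ (fun z => z - y) '' Y, ∀ q ∈ (fun z => z - y) '' Y, p ≠ q → δ ≤ dist p q := by
  rintro p ⟨p', hp', rfl⟩ q ⟨q', hq', rfl⟩ hpq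
  have hne : p' ≠ q' := fun h => hpq (by rw [h])
  have := hY p' hp' q' hq' hne
  rwa [dist_sub_right]

/-- **The transfer `Layering ∧ C⁺ ⇒ crux`, kernel-checked.**  Assume LAYERING on the window (exact
linearly rotated Barlow `6a/5`-stars at every point of a set `Y ∋ 0` force `Y` to be one linearly
rotated Barlow stacking).  If moreover the STRICT STAR CERTIFICATE exists — relaxed-hcp
spacings `a, h` with `0.775a < h < 0.894a`; a split `V_LJ = g + U + f` on `(0,∞)` with `U ≥ 0`
continuous, `g ≡ 0` beyond `ρ`, `f` of positive type; a one-centre star functional `F ≥ 0` with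
`Σ_i F(star_i) ≤ Σ_{i<j} g + cN` on injective configurations, uniformly continuous in the local
matching topology on `1/3`-separated rooted sets; (S1) `F`-tight separated rooted stars are linearly
rotated Barlow `6a/5`-stars of spacing `(a,h)`; (S2) `U(√(16a²/3 + 4h²)) > 0`; and the exact constant
`c + f(0)/2 = −e(hcp(a,h))` — then `SlackRigidity` holds, with witness `hcpPeriodicConfiguration a h`.
Proof: if `RigidFor` failed, rooting (+ thinning + trial bound) and the local limit give a zero-slack
`1/3`-separated `Y ∋ 0` unmatched at its root; (S1) + layering make `Y` a rotated Barlow stacking on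
whose distances `U` vanishes; (S2) forbids the c-layer witness distance, so the stacking is rotated
hcp, which IS matched at its root — contradiction. [folklore] -/
theorem slackRigidity_of_layering_of_strictCertificate :
    (∀ (a h : ℝ), 0 < a → 0 < h → 0.775 * a < h → h < 0.894 * a →
      ∀ Y : Set E3, (0 : E3) ∈ Y →
      (∀ y ∈ Y, ∃ s : ℤ → ℤ, IsHaggSeq s ∧ ∃ B : E3 →ₗᵢ[ℝ] E3,
        ((fun z => z - y) '' Y) ∩ Metric.closedBall 0 (6 * a / 5) =
          B '' (barlowStacking a h s ∩ Metric.closedBall 0 (6 * a / 5))) →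
      ∃ s : ℤ → ℤ, IsHaggSeq s ∧ ∃ A : E3 →ₗᵢ[ℝ] E3, Y = A '' barlowStacking a h s) →
    (∃ (a h : ℝ) (ha : 0 < a) (hh : 0 < h), 0.775 * a < h ∧ h < 0.894 * a ∧
    ∃ (ρ c ρ' : ℝ) (g U f : ℝ → ℝ) (F : Set E3 → ℝ),
      (∀ r : ℝ, 0 < r → lennardJones r = g r + U r + f r) ∧
      (∀ r : ℝ, 0 < r → 0 ≤ U r) ∧
      ContinuousOn U (Set.Ioi 0) ∧
      (∀ r : ℝ, ρ ≤ r → g r = 0) ∧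
      (∀ (n : ℕ) (y : Fin n → E3) (w : Fin n → ℝ),
        0 ≤ ∑ i, ∑ j, w i * w j * f (dist (y i) (y j))) ∧
      (∀ T : Set E3, 0 ≤ F T) ∧
      (∀ (N : ℕ) (x : Fin N → E3), Function.Injective x →
        ∑ i, F (((fun z => z - x i) '' Set.range x) ∩ Metric.closedBall 0 ρ') ≤
          interactionEnergy g x + c * N) ∧
      (∀ ε : ℝ, 0 < ε → ∃ η : ℝ, 0 < η ∧ ∀ S T : Set E3,
        (∀ p ∈ S, ∀ q ∈ S, p ≠ q → (1 / 3 : ℝ) ≤ dist p q) →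
        (∀ p ∈ T, ∀ q ∈ T, p ≠ q → (1 / 3 : ℝ) ≤ dist p q) →
        (0 : E3) ∈ S → (0 : E3) ∈ T → BallMatch η (ρ' + 1) 0 S T →
        |F (S ∩ Metric.closedBall 0 ρ') - F (T ∩ Metric.closedBall 0 ρ')| ≤ ε) ∧
      (∀ T : Set E3, (∀ p ∈ T, ∀ q ∈ T, p ≠ q → (1 / 3 : ℝ) ≤ dist p q) → (0 : E3) ∈ T →
        F (T ∩ Metric.closedBall 0 ρ') = 0 →
        ∃ s : ℤ → ℤ, IsHaggSeq s ∧ ∃ B : E3 →ₗᵢ[ℝ] E3,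
          T ∩ Metric.closedBall 0 (6 * a / 5) =
            B '' (barlowStacking a h s ∩ Metric.closedBall 0 (6 * a / 5))) ∧
      0 < U (Real.sqrt (16 * a ^ 2 / 3 + 4 * h ^ 2)) ∧
      c + f 0 / 2 = -((hcpPeriodicConfiguration ha.ne' hh.ne').energyPerParticle lennardJones)) →
    SlackRigidity := by
  classical
  rintro layering ⟨a, h, ha, hh, hw1, hw2, -, c, ρ', g, U, f, F, hsplit, hU0, hUc, -, hf, hF0, hstar,
    hcont, hS1, hS2, hid⟩
  rw [slackRigidity_iff]
  refine ⟨hcpPeriodicConfiguration ha.ne' hh.ne', ?_⟩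
  by_contra hrig
  -- Stubs 2, 3 and the landed trial-state bound: a rooted small-slack bad sequence
  obtain ⟨R, ε, hR, hε, S, hsep, h0, hbad, hsmall⟩ :=
    CLayerWitnessRooting.stub_rooting CLayerWitnessThinning.stub_thinning (hcpPeriodicConfiguration ha.ne' hh.ne') c ρ' g U f F hsplit hU0 hf
      hF0 hstar hid (stub_trialBound (hcpPeriodicConfiguration ha.ne' hh.ne')) hrig
  -- Stub 4: a zero-slack local limit, unmatched at the root
  obtain ⟨Y, hYsep, hY0, hYF, hYU, hYbad⟩ :=
    CLayerWitnessLocalLimit.stub_localLimit (hcpPeriodicConfiguration ha.ne' hh.ne') ρ' R ε U F S hε hU0 hUc hF0 hcont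
      hsep h0 hbad hsmall
  -- (S1): every star of `Y` is a rotated Barlow 12-star of `hcp(a,h)` geometry
  have hloc : ∀ y ∈ Y, ∃ s : ℤ → ℤ, IsHaggSeq s ∧ ∃ B : E3 →ₗᵢ[ℝ] E3,
      ((fun z => z - y) '' Y) ∩ Metric.closedBall 0 (6 * a / 5) =
        B '' (barlowStacking a h s ∩ Metric.closedBall 0 (6 * a / 5)) := by
    intro y hy
    exact hS1 ((fun z => z - y) '' Y) (separated_image_sub hYsep y) ⟨y, hy, sub_self y⟩ (hYF y hy)
  -- Stub 5: `Y` is one rotated Barlow stacking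
  obtain ⟨s, hs, A, hYeq⟩ := layering a h ha hh hw1 hw2 Y hY0 hloc
  -- (S2) and `U`-tightness of `Y`: the witness distance is not realised by the stacking
  have hnot : ∀ x ∈ barlowStacking a h s, ∀ y ∈ barlowStacking a h s,
      dist x y ^ 2 ≠ 16 * a ^ 2 / 3 + 4 * h ^ 2 := by
    intro x hx y hy heq
    have hpos : 0 < 16 * a ^ 2 / 3 + 4 * h ^ 2 := by positivity
    have hxy : x ≠ y := by
      rintro rfl
      rw [dist_self] at heq
      have h00 : (0 : ℝ) ^ 2 = 0 := by norm_num
      rw [h00] at heq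
      linarith
    have hAx : A x ∈ Y := by rw [hYeq]; exact ⟨x, hx, rfl⟩
    have hAy : A y ∈ Y := by rw [hYeq]; exact ⟨y, hy, rfl⟩
    have hAne : A x ≠ A y := fun h' => hxy (A.injective h')
    have hU := hYU (A x) hAx (A y) hAy hAne
    rw [LinearIsometry.dist_map] at hU
    have hd : Real.sqrt (16 * a ^ 2 / 3 + 4 * h ^ 2) = dist x y := by
      rw [← heq, Real.sqrt_sq dist_nonneg]
    rw [← hd] at hU
    exact absurd hU (ne_of_gt hS2)
  -- Stub 6: the stacking is rotated hcp
  obtain ⟨B, hB⟩ := CLayerWitnessWitness.stub_witness a h ha hh s hs hnot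
  -- hence `Y = (A ∘ B) '' P.points` is matched at the root: contradiction
  apply hYbad
  refine ⟨A.comp B, ?_, ?_⟩
  · intro p hp _
    refine ⟨A (B p), ?_, ?_⟩
    · rw [hYeq]
      refine ⟨B p, ?_, rfl⟩
      rw [hB]
      refine ⟨p, ?_, rfl⟩
      rwa [hcpPeriodicConfiguration_points] at hp
    · rw [LinearIsometry.coe_comp, Function.comp_apply, dist_self]
      exact (half_pos hε).le
  · intro q hq _
    rw [hYeq] at hq
    obtain ⟨x, hx, rfl⟩ := hq
    rw [hB] at hx
    obtain ⟨p, hp, rfl⟩ := hx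
    refine ⟨p, ?_, ?_⟩
    · rw [hcpPeriodicConfiguration_points]; exact hp
    · rw [LinearIsometry.coe_comp, Function.comp_apply, dist_self]
      exact (half_pos hε).le


end Summit.AtomisticToContinuum.Crystallization.Theorems.CLayerWitnessReduction

end
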